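import Summits.BirchSwinnertonDyer.BirchSwinnertonDyer.Theorems.GenusKolyvaginAtTwoPowDvdShaCardAtTwoRTAuxiliaryClassCount
import Summits.BirchSwinnertonDyer.BirchSwinnertonDyer.Theorems.SchneiderFreeAdditiveX3PoitouTateLocalDualityEveryPlace
import HarnessLib

/-!
# Route `GenusKolyvaginAtTwo`, crux L_T `PowDvdShaCardAtTwoRT` (stmt-BirchSwinnertonDyer-23242), LINE 18/19 stub 3a⁗, step (b):
# LAGRANGIAN REDUCTION and the DEPTH of a coisotropic subgroup — the algebra of a «deep Prop. 2.1»

Seat `bsd-line-gk2-p3` g19 (cell `bsd-f1-sign2`), `--supports 23242 --as helper`. Finite-group algebra only (imports X11b's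
`FiniteDuality` annihilator API); THEOREMS ONLY. BSD is not proved by any of this; neither is the crux.

WHY (memo `Cruxes/PowDvdShaCardAtTwoRT/Lines/plus-descent-step-b-levels.md`, §2(b)): McCallum's swap step (proof of Prop. 5.2) needs an
auxiliary class that is not merely non-zero (Prop. 2.1 as printed, tree `…RTAuxiliaryClass.exists_ne_zero_mem_kummerOutside`) but DEEP
(order `≥ p^{M_r+2}`), because the Kolyvagin class `c_{M_r+1}(nl′)` cannot be detected by a level-`p` partner when `M_r ≥ 1`. McCallum's own
device gives depth for free once read through symplectic linear algebra: the image `G` of `H¹(K_T/K, E[p^M])` in `V = ⊕_{v∈T} H¹(K_v, E[p^M])`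
is LAGRANGIAN (`G = G^⊥`, tree `…RTAuxiliaryClassCount.annLeft_map_kummerOutside_eq`); cutting `G` by Lagrangian local conditions `H_v` at
`v ∈ T − {w}` and projecting to the free place `w` gives a LAGRANGIAN `R ⊂ H¹(K_w, E[p^M])` (§2, «Lagrangian reduction»); and a
coisotropic subgroup `R ⊇ R^⊥` of a group containing an element of order `p^M` contains an element of order `≥ p^{⌈M/2⌉}` (§3: if `p^e` is
the exponent of `R` then `p^e·x₀ ∈ R^⊥ ⊆ R`, so `p^{2e} x₀ = 0`).

* (§1 = the tree's `SchneiderFreeAdditiveX3.PoitouTateReduction.annLeft_inf`: `{}^⊥(Y ⊓ Y′) = {}^⊥Y ⊔ {}^⊥Y′` for a perfect pairing.)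
* §2 `map_inf_le_annLeft_map_inf` / `annLeft_map_inf_le` / `annLeft_map_inf_eq` — LAGRANGIAN REDUCTION: `V` with a perfect self-pairing
  `b`, `G = {}^⊥G`, `C ⊇ {}^⊥C` (coisotropic), a «coordinate» `π : V →+ A` with a set-theoretic section `s` (`π ∘ s = id`, `s(A) ⊆ C`,
  `b(s a, x) = b_A(a, π x)`), `π` killing `{}^⊥C`, and `b = b_A ∘ π` on `C × C`; then `R := π(G ∩ C)` satisfies `{}^⊥R = R` for `b_A`.
* §3 `exists_mem_addOrderOf_dvd_sq` — `R ⊇ {}^⊥R` (for ANY biadditive `b_A`), `x₀ ∈ A` ⟹ `∃ r ∈ R, ord x₀ ∣ (ord r)²`;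
  `exists_mem_addOrderOf_eq_pow_le_two_mul` — the `p`-primary numeric form (`ord x₀ = p^M ⟹ ∃ r ∈ R, ord r = p^j, M ≤ 2j`).

Instantiation (not in this file): `V = Π_{u∈T} H¹(K_u, E[2^M])` with gk2-p4's sum pairing `bP`, `π = eval w`, `s = Pi.single w`,
`C = {x | ∀ u ≠ w, x u ∈ H u}` with `H u` Lagrangian (Kummer or, at own Kolyvagin primes, transverse — `…TransverseIsotropic`),
`x₀` = a local class of order `2^M` at `w` (the unramified or the transverse generator).

References: [McCallumLMS1991] §2 Prop. 2.1 (proof), §5 proof of Prop. 5.2; [MilneADT2006] I Prop. 0.19, Thm. 4.10.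
-/

set_option autoImplicit false
-- `Summit.<P>.<Sub>` repeats `BirchSwinnertonDyer` by the tree's layout convention (D-0017)
set_option linter.dupNamespace false

namespace Summit.BirchSwinnertonDyer.BirchSwinnertonDyer.Theorems.GenusExact.LagrangianReduction

open Function AddSubgroup
open Summit.BirchSwinnertonDyer.Rank1Residual.X11b.FiniteDuality
open Summit.BirchSwinnertonDyer.BirchSwinnertonDyer.Theorems.SchneiderFreeAdditiveX3.PoitouTateReduction (annLeft_inf)

/-! ## §2 Lagrangian reduction -/

section Reduction

variable {V : Type*} [AddCommGroup V] {A : Type*} [AddCommGroup A] {n : ℕ}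

/-- **Reduction of an isotropic subgroup is isotropic**: if `b(g, g′) = 0` on `G` and `b = b_A ∘ π` on `C × C`, then `R = π(G ∩ C)` is
isotropic for `b_A`: `R ≤ {}^⊥R`. [folklore] -/
theorem map_inf_le_annLeft_map_inf (b : V →+ V →+ ZMod n) (bA : A →+ A →+ ZMod n) (G C : AddSubgroup V) (π : V →+ A)
    (hG : G ≤ annLeft b G) (hC : ∀ x ∈ C, ∀ y ∈ C, b x y = bA (π x) (π y)) :
    (G ⊓ C).map π ≤ annLeft bA ((G ⊓ C).map π) := by
  rintro _ ⟨g, ⟨hgG, hgC⟩, rfl⟩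
  rw [mem_annLeft_iff]
  rintro _ ⟨g', ⟨hg'G, hg'C⟩, rfl⟩
  rw [← hC g hgC g' hg'C]
  exact hG hgG g' hg'G

/-- **Lagrangian reduction (the coisotropic half).** `V` finite killed by `n` with a perfect pairing `b` (both adjoints bijective);
`G ≤ V` with `{}^⊥G ≤ G`; `C ≤ V` COISOTROPIC (`{}^⊥C ≤ C`); a coordinate `π : V →+ A` with a section `s : A → V` (`π (s a) = a`,
`s a ∈ C`, `b (s a) x = b_A a (π x)` for all `x`), and `π` killing `{}^⊥C`. Then `R := π(G ⊓ C)` satisfies **`{}^⊥R ≤ R`**: for `a ⊥ R`,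
`s a ∈ {}^⊥(G ⊓ C) = {}^⊥G ⊔ {}^⊥C ≤ G ⊔ {}^⊥C`, so `s a = g + c′` with `g ∈ G ∩ C` and `π g = a`. (Symplectic reduction
`(G ∩ C)/(G ∩ C^⊥) ↪ C/C^⊥` of a Lagrangian is Lagrangian.) [cite: McCallumLMS1991, §2 proof of Prop. 2.1] -/
theorem annLeft_map_inf_le [Finite V] [NeZero n] (hV : ∀ x : V, n • x = 0) (b : V →+ V →+ ZMod n) (hb : Bijective b)
    (hflip : Bijective b.flip) (bA : A →+ A →+ ZMod n) (G C : AddSubgroup V) (π : V →+ A) (s : A → V)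
    (hG : annLeft b G ≤ G) (hC : annLeft b C ≤ C) (hπs : ∀ a, π (s a) = a) (hsC : ∀ a, s a ∈ C)
    (hbs : ∀ a x, b (s a) x = bA a (π x)) (hπC : ∀ c ∈ annLeft b C, π c = 0) :
    annLeft bA ((G ⊓ C).map π) ≤ (G ⊓ C).map π := by
  intro a ha
  rw [mem_annLeft_iff] at ha
  -- `s a` annihilates `G ⊓ C`
  have hsa : s a ∈ annLeft b (G ⊓ C) := by
    rw [mem_annLeft_iff]
    rintro g ⟨hgG, hgC⟩
    rw [hbs]
    exact ha (π g) ⟨g, ⟨hgG, hgC⟩, rfl⟩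
  rw [annLeft_inf hV hV b hb hflip] at hsa
  obtain ⟨g, hg, c', hc', hsum⟩ := AddSubgroup.mem_sup.mp hsa
  have hgG : g ∈ G := hG hg
  have hc'C : c' ∈ C := hC hc'
  have hgC : g ∈ C := by
    have : g = s a - c' := by rw [← hsum, add_sub_cancel_right]
    rw [this]
    exact C.sub_mem (hsC a) hc'C
  refine ⟨g, ⟨hgG, hgC⟩, ?_⟩
  have h := congrArg π hsum
  rw [map_add, hπC c' hc', add_zero, hπs] at h
  exact h

/-- **Lagrangian reduction**: under the hypotheses of `annLeft_map_inf_le` plus isotropy of `G` (`G ≤ {}^⊥G`) and `b = b_A ∘ π` on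
`C × C` (the other coordinates pair to zero on `C`), `R = π(G ⊓ C)` is LAGRANGIAN for `b_A`: `{}^⊥R = R`. [cite: McCallumLMS1991, §2 proof of Prop. 2.1] -/
theorem annLeft_map_inf_eq [Finite V] [NeZero n] (hV : ∀ x : V, n • x = 0) (b : V →+ V →+ ZMod n) (hb : Bijective b)
    (hflip : Bijective b.flip) (bA : A →+ A →+ ZMod n) (G C : AddSubgroup V) (π : V →+ A) (s : A → V)
    (hG : annLeft b G = G) (hC : annLeft b C ≤ C) (hπs : ∀ a, π (s a) = a) (hsC : ∀ a, s a ∈ C)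
    (hbs : ∀ a x, b (s a) x = bA a (π x)) (hπC : ∀ c ∈ annLeft b C, π c = 0)
    (hCC : ∀ x ∈ C, ∀ y ∈ C, b x y = bA (π x) (π y)) :
    annLeft bA ((G ⊓ C).map π) = (G ⊓ C).map π :=
  le_antisymm (annLeft_map_inf_le hV b hb hflip bA G C π s hG.le hC hπs hsC hbs hπC)
    (map_inf_le_annLeft_map_inf b bA G C π hG.ge hCC)

end Reduction

/-! ## §3 Depth: a coisotropic subgroup contains an element of order at least the square root of any order in the group -/

section Depth

variable {A : Type*} [AddCommGroup A] {C' : Type*} [AddCommGroup C']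

/-- **`R ⊇ {}^⊥R ⟹ ∃ r ∈ R, ord(x₀) ∣ ord(r)²`** (any biadditive `b` with values in any group, `R` finite): with `p^e := exp R` one has
`e·x₀ ⊥ R` (bilinearity: `b(e x₀, r) = b(x₀, e r) = 0`), so `e·x₀ ∈ R` and `e·(e·x₀) = 0`; take `r` of order `exp R`. [folklore] -/
theorem exists_mem_addOrderOf_dvd_sq (b : A →+ A →+ C') (R : AddSubgroup A) [Finite R]
    (hR : ∀ a : A, (∀ r ∈ R, b a r = 0) → a ∈ R) (x₀ : A) :
    ∃ r ∈ R, addOrderOf x₀ ∣ addOrderOf r ^ 2 := by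
  obtain ⟨r, hr⟩ := AddMonoid.exists_addOrderOf_eq_exponent (AddMonoid.ExponentExists.of_finite (G := R))
  refine ⟨r, r.2, ?_⟩
  have hE : ∀ y ∈ R, AddMonoid.exponent R • y = 0 := fun y hy ↦ by
    have h := AddMonoid.exponent_nsmul_eq_zero (G := R) ⟨y, hy⟩
    exact congrArg Subtype.val h
  have hmem : AddMonoid.exponent R • x₀ ∈ R := hR _ fun y hy ↦ by
    rw [map_nsmul, AddMonoidHom.nsmul_apply, ← map_nsmul, hE y hy, map_zero]
  have h0 : (AddMonoid.exponent R * AddMonoid.exponent R) • x₀ = 0 := by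
    rw [← smul_smul]
    exact hE _ hmem
  rw [AddSubgroup.addOrderOf_coe, hr, sq]
  exact addOrderOf_dvd_of_nsmul_eq_zero h0

/-- **Numeric form in a `p`-group**: if `p^k` kills `A`, `R ⊇ {}^⊥R`, and `x₀ ∈ A` has order `p^M`, then `R` contains an element of
order `p^j` with `M ≤ 2j` — e.g. a Lagrangian `R ⊂ H¹(ℚ_ℓ, E[2^M])` contains a class of order `≥ 2^{⌈M/2⌉}` (the «deep Prop. 2.1» of
the memo: McCallum's auxiliary class can be taken of order `≥ 2^{⌈M/2⌉}`). [cite: McCallumLMS1991, §2 Prop. 2.1 and §5 proof of Prop. 5.2] -/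
theorem exists_mem_addOrderOf_eq_pow_le_two_mul {p k : ℕ} (hp : p.Prime) (hA : ∀ a : A, p ^ k • a = 0)
    (b : A →+ A →+ C') (R : AddSubgroup A) [Finite R] (hR : ∀ a : A, (∀ r ∈ R, b a r = 0) → a ∈ R)
    {x₀ : A} {M : ℕ} (hx₀ : addOrderOf x₀ = p ^ M) :
    ∃ r ∈ R, ∃ j : ℕ, addOrderOf r = p ^ j ∧ M ≤ 2 * j := by
  obtain ⟨r, hr, hdvd⟩ := exists_mem_addOrderOf_dvd_sq b R hR x₀
  have hr' : addOrderOf r ∣ p ^ k := addOrderOf_dvd_of_nsmul_eq_zero (hA r)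
  obtain ⟨j, -, hrj⟩ := (Nat.dvd_prime_pow hp).mp hr'
  refine ⟨r, hr, j, hrj, ?_⟩
  rw [hx₀, hrj, ← pow_mul] at hdvd
  have h := (Nat.pow_dvd_pow_iff_le_right hp.one_lt).mp hdvd
  omega

end Depth

/-! ## §4 The product form: reduction to one coordinate of `Π_i X_i` with the sum pairing -/

section Product

open Summit.BirchSwinnertonDyer.BirchSwinnertonDyer.Theorems.GenusExact.AuxiliaryClass

variable {ι : Type*} [Fintype ι] [DecidableEq ι] {X : ι → Type*} [∀ i, AddCommGroup (X i)] {n : ℕ}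

/-- The sum pairing against a vector supported at one index, on the LEFT. [folklore] -/
theorem piSum_single_left (b : ∀ i, X i →+ X i →+ ZMod n) (bP : (∀ i, X i) →+ (∀ i, X i) →+ ZMod n)
    (hbP : ∀ x y, bP x y = ∑ i, b i (x i) (y i)) (i : ι) (a : X i) (y : ∀ i, X i) :
    bP (Pi.single i a) y = b i a (y i) := by
  rw [hbP, Finset.sum_eq_single i]
  · rw [Pi.single_eq_same]
  · intro j _ hj
    rw [Pi.single_eq_of_ne hj, map_zero, AddMonoidHom.zero_apply]
  · intro hi
    exact absurd (Finset.mem_univ i) hi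

/-- **Lagrangian reduction on a finite product** (the shape of McCallum's proof of Prop. 2.1, made quantitative): `X_i` finite killed
by `n` with perfect pairings `b_i` (both adjoints injective), `bP = ∑_i b_i` the sum pairing, `G ≤ Π_i X_i` LAGRANGIAN (`{}^⊥G = G`, e.g.
the image of `H¹(K_T/K, E[p^M])`, tree `annLeft_map_kummerOutside_eq`), `H_i ≤ X_i` Lagrangian local conditions at the indices
`i ≠ w`. Then the `w`-coordinates of the elements of `G` satisfying the conditions `H_i` (`i ≠ w`) form a LAGRANGIAN subgroup of `X_w`.
[cite: McCallumLMS1991, §2 proof of Prop. 2.1] [cite: MilneADT2006, Ch. I Thm. 4.10] -/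
theorem annLeft_map_eval_eq [∀ i, Finite (X i)] [NeZero n] (hX : ∀ i (x : X i), n • x = 0)
    (b : ∀ i, X i →+ X i →+ ZMod n) (hb : ∀ i, Injective (b i)) (hbflip : ∀ i, Injective (b i).flip)
    (bP : (∀ i, X i) →+ (∀ i, X i) →+ ZMod n) (hbP : ∀ x y, bP x y = ∑ i, b i (x i) (y i))
    (w : ι) (H : ∀ i, AddSubgroup (X i)) (hH : ∀ i, i ≠ w → annLeft (b i) (H i) = H i)
    (G : AddSubgroup (∀ i, X i)) (hG : annLeft bP G = G) :
    annLeft (b w) ((G ⊓ AddSubgroup.pi {i | i ≠ w} H).map (Pi.evalAddMonoidHom X w)) =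
      (G ⊓ AddSubgroup.pi {i | i ≠ w} H).map (Pi.evalAddMonoidHom X w) := by
  haveI : Finite (∀ i, X i) := Pi.finite
  set C : AddSubgroup (∀ i, X i) := AddSubgroup.pi {i | i ≠ w} H with hCdef
  have hmemC : ∀ x : ∀ i, X i, x ∈ C ↔ ∀ i, i ≠ w → x i ∈ H i := fun x ↦ by
    rw [hCdef, AddSubgroup.mem_pi]; rfl
  have hV : ∀ x : (∀ i, X i), n • x = 0 := fun x ↦ funext fun i ↦ by
    rw [Pi.smul_apply, Pi.zero_apply, hX i (x i)]
  have hbPb : Bijective bP := bijective_piSum hX b hb bP hbP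
  have hbPflip : ∀ x y, bP.flip x y = ∑ i, (b i).flip (x i) (y i) := fun x y ↦ by
    rw [AddMonoidHom.flip_apply, hbP]
    exact Finset.sum_congr rfl fun i _ ↦ (AddMonoidHom.flip_apply _ _ _).symm
  have hbPf : Bijective bP.flip := bijective_piSum hX (fun i ↦ (b i).flip) hbflip bP.flip hbPflip
  have hsingleC : ∀ (i : ι) (h : X i), (i ≠ w → h ∈ H i) → Pi.single i h ∈ C := by
    intro i h hh
    rw [hmemC]
    intro j hj
    by_cases hji : j = i
    · subst hji; rw [Pi.single_eq_same]; exact hh hj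
    · rw [Pi.single_eq_of_ne hji]; exact (H j).zero_mem
  -- `C` is coisotropic
  have hC : annLeft bP C ≤ C := by
    intro c hc
    rw [mem_annLeft_iff] at hc
    rw [hmemC]
    intro i hi
    rw [← hH i hi, mem_annLeft_iff]
    intro h hh
    rw [← piSum_single b bP hbP c i h]
    exact hc _ (hsingleC i h fun _ ↦ hh)
  -- `π` kills `{}^⊥C`
  have hπC : ∀ c ∈ annLeft bP C, Pi.evalAddMonoidHom X w c = 0 := by
    intro c hc
    rw [mem_annLeft_iff] at hc
    rw [Pi.evalAddMonoidHom_apply]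
    apply hb w
    ext y
    rw [map_zero, AddMonoidHom.zero_apply, ← piSum_single b bP hbP c w y]
    exact hc _ (hsingleC w y fun h ↦ absurd rfl h)
  -- on `C × C` only the `w`-coordinate pairs
  have hCC : ∀ x ∈ C, ∀ y ∈ C, bP x y = b w (Pi.evalAddMonoidHom X w x) (Pi.evalAddMonoidHom X w y) := by
    intro x hx y hy
    rw [hbP, Pi.evalAddMonoidHom_apply, Pi.evalAddMonoidHom_apply, Finset.sum_eq_single w]
    · intro i _ hi
      have hxi : x i ∈ annLeft (b i) (H i) := by rw [hH i hi]; exact (hmemC x).mp hx i hi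
      exact hxi _ ((hmemC y).mp hy i hi)
    · intro hw
      exact absurd (Finset.mem_univ w) hw
  exact annLeft_map_inf_eq hV bP hbPb hbPf (b w) G C (Pi.evalAddMonoidHom X w) (Pi.single w) hG hC
    (fun a ↦ by rw [Pi.evalAddMonoidHom_apply, Pi.single_eq_same]) (fun a ↦ hsingleC w a fun h ↦ absurd rfl h)
    (fun a x ↦ by rw [Pi.evalAddMonoidHom_apply]; exact piSum_single_left b bP hbP w a x) hπC hCC

/-- **Depth of the reduction («deep Prop. 2.1», algebraic core).** In the setting of `annLeft_map_eval_eq`, for every `x₀ ∈ X_w` there is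
`g ∈ G` satisfying the local conditions `g_i ∈ H_i` (`i ≠ w`) whose `w`-coordinate has `ord(x₀) ∣ ord(g_w)²`; in a `p`-group with
`ord(x₀) = p^M` this is an admissible class of order `≥ p^{⌈M/2⌉}` at `w` (hence globally). [cite: McCallumLMS1991, §2 Prop. 2.1 and §5 proof of Prop. 5.2] -/
theorem exists_mem_addOrderOf_dvd_sq_eval [∀ i, Finite (X i)] [NeZero n] (hX : ∀ i (x : X i), n • x = 0)
    (b : ∀ i, X i →+ X i →+ ZMod n) (hb : ∀ i, Injective (b i)) (hbflip : ∀ i, Injective (b i).flip)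
    (bP : (∀ i, X i) →+ (∀ i, X i) →+ ZMod n) (hbP : ∀ x y, bP x y = ∑ i, b i (x i) (y i))
    (w : ι) (H : ∀ i, AddSubgroup (X i)) (hH : ∀ i, i ≠ w → annLeft (b i) (H i) = H i)
    (G : AddSubgroup (∀ i, X i)) (hG : annLeft bP G = G) (x₀ : X w) :
    ∃ g ∈ G, (∀ i, i ≠ w → g i ∈ H i) ∧ addOrderOf x₀ ∣ addOrderOf (g w) ^ 2 := by
  set R := (G ⊓ AddSubgroup.pi {i | i ≠ w} H).map (Pi.evalAddMonoidHom X w) with hRdef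
  haveI : Finite R := inferInstance
  have hR : ∀ a : X w, (∀ r ∈ R, b w a r = 0) → a ∈ R := fun a ha ↦ by
    have h : a ∈ annLeft (b w) R := (mem_annLeft_iff _ _ _).mpr ha
    rwa [annLeft_map_eval_eq hX b hb hbflip bP hbP w H hH G hG] at h
  obtain ⟨r, hr, hdvd⟩ := exists_mem_addOrderOf_dvd_sq (b w) R hR x₀
  obtain ⟨g, ⟨hgG, hgC⟩, rfl⟩ := hr
  refine ⟨g, hgG, fun i hi ↦ ?_, hdvd⟩
  have hgC' : g ∈ AddSubgroup.pi {i | i ≠ w} H := hgC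
  exact (AddSubgroup.mem_pi _).mp hgC' i hi

end Product

end Summit.BirchSwinnertonDyer.BirchSwinnertonDyer.Theorems.GenusExact.LagrangianReduction
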